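import Summits.Ventures.PercRepro.C041InvStar
import Summits.Ventures.PercRepro.C041CutGlueProduct

/-!
# The star gadget as a `CutGlue.Space`: LEMMA (INV-STAR) feeds LEMMA G (p6, gen 25; C-041.md §10 (a), (b), (f))

The abstract star model of `C041InvStar` is a gadget in the sense of `C041CutGlueDefs`: `starSpace kt ko` has the
states `(A, τ)` weighted by admissibility, the Good bits `GoodS` (side `t`) and `GoodS'` (side `j`, read through
the swap of the terminals), validity `¬ InvalidS`, and the reach bits `RhoS` / `RhoS'` at `u″ = k`.  Its counts are
the star model's (`I_starSpace`, `m₁_starSpace`, `m₂_starSpace`), so LEMMA (INV-STAR) is exactly the abstract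
hypothesis (INV) of `phi_glue_ge_of_INV` / `INV_glue_right` / `INV_glue_left` (`starSpace_INV`):
* `phi_glue_star`: gluing a star gadget at `k` to any sub-problem `Q`, `Φ(glue) ≥ I·Φ(Q) + Φ(star)·N(Q)` — (O-CUBE)
  for the glue from (O-CUBE) on the pieces (`phi_glue_star_nonneg`);
* `INV_glue_star_left`: (INV) for the glue of a star gadget with anything, at the star's centre.
NOT claimed: that a skeleton's pendant star is this gadget (the reading of §10 (f); the percolation side is not
typed).
-/

namespace PercRepro

namespace InvStar

open Finset CutGlue

variable {ι : Type*} [Fintype ι] [DecidableEq ι] (kt ko : ι → ℕ)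

/-- `G_j` of a star state: `GoodS` on the other side, read through the swap of the terminals. -/
def GoodS' (s : StarState ι kt ko) : Prop := GoodS (swapState kt ko s)

/-- `ρ_j` of a star state: `RhoS` on the other side, read through the swap of the terminals. -/
def RhoS' (s : StarState ι kt ko) : Prop := RhoS (swapState kt ko s)

open Classical in
/-- **The star gadget as a `CutGlue.Space`**: states weighted by admissibility, Good bits `GoodS` / `GoodS'`,
validity `¬ InvalidS`. -/
noncomputable def starSpace : Space (StarState ι kt ko) where
  w s := if AdmS s then 1 else 0
  G₁ := GoodS
  G₂ := GoodS' kt ko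
  V s := ¬ InvalidS s
  hG₁ _ h hinv := not_goodS_of_invalidS hinv h
  hG₂ _ h hinv := not_goodS_of_invalidS ((invalidS_swap _).2 hinv) h

open Classical in
/-- A weighted count of the star gadget is a cardinality. -/
theorem cnt_starSpace (p : StarState ι kt ko → Prop) :
    (starSpace kt ko).cnt p = ((univ.filter fun s : StarState ι kt ko => AdmS s ∧ p s).card : ℤ) := by
  unfold Space.cnt starSpace
  rw [Finset.card_filter]
  push_cast
  apply Finset.sum_congr rfl
  intro s _
  by_cases hp : p s <;> by_cases ha : AdmS s <;> simp [hp, ha]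

open Classical in
/-- `I` of the star gadget is the star model's invalid count. -/
theorem I_starSpace : (starSpace kt ko).I = invalidCountS kt ko := by
  unfold Space.I invalidCountS
  rw [cnt_starSpace]
  congr 2
  ext s
  simp only [Finset.mem_filter, Finset.mem_univ, true_and]
  show AdmS s ∧ ¬ ¬ InvalidS s ↔ AdmS s ∧ InvalidS s
  rw [not_not]

open Classical in
/-- `m_t` of the star gadget at its centre is the star model's `m_t`. -/
theorem m₁_starSpace : (starSpace kt ko).m₁ RhoS = mCountS kt ko := by
  unfold Space.m₁ mCountS
  rw [cnt_starSpace]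
  congr 2
  ext s
  simp only [Finset.mem_filter, Finset.mem_univ, true_and]
  constructor
  · rintro ⟨h1, h2, h3⟩
    exact ⟨h1, h2, h3⟩
  · rintro ⟨h1, h2, h3⟩
    exact ⟨h1, h2, h3⟩

open Classical in
/-- `m_j` of the star gadget at its centre is the star model's `m_j`. -/
theorem m₂_starSpace : (starSpace kt ko).m₂ (RhoS' kt ko) = mCountS' kt ko := by
  unfold Space.m₂ mCountS'
  rw [cnt_starSpace]
  congr 2
  ext s
  simp only [Finset.mem_filter, Finset.mem_univ, true_and]
  constructor
  · rintro ⟨h1, h2, h3⟩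
    exact ⟨h1, h2, h3⟩
  · rintro ⟨h1, h2, h3⟩
    exact ⟨h1, h2, h3⟩

/-- **LEMMA (INV-STAR) as the abstract (INV) hypothesis**: `I ≤ m_t` and `I ≤ m_j` for the star gadget. -/
theorem starSpace_INV :
    (starSpace kt ko).I ≤ (starSpace kt ko).m₁ RhoS ∧ (starSpace kt ko).I ≤ (starSpace kt ko).m₂ (RhoS' kt ko) := by
  rw [I_starSpace, m₁_starSpace, m₂_starSpace]
  exact_mod_cast invalidCountS_le_mCountS' kt ko

variable {X : Type*} [Fintype X]

/-- **LEMMA G with a star gadget** (C-041.md §10 (a) + (f)): gluing the star gadget at its centre to any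
sub-problem `Q`, `Φ(glue) ≥ I·Φ(Q) + Φ(star)·N(Q)`. -/
theorem phi_glue_star (Q : Space X) :
    (starSpace kt ko).I * Q.phi + (starSpace kt ko).phi * Q.N ≤
      (glue (starSpace kt ko) RhoS (RhoS' kt ko) Q).phi :=
  phi_glue_ge_of_INV _ _ _ Q (starSpace_INV kt ko).1 (starSpace_INV kt ko).2

/-- **(O-CUBE) for a star gadget glued to anything** follows from `Φ ≥ 0` on the two pieces. -/
theorem phi_glue_star_nonneg (Q : Space X) (hP : 0 ≤ (starSpace kt ko).phi) (hQ : 0 ≤ Q.phi) :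
    0 ≤ (glue (starSpace kt ko) RhoS (RhoS' kt ko) Q).phi :=
  phi_glue_nonneg_of_INV _ _ _ Q hP hQ (starSpace_INV kt ko).1 (starSpace_INV kt ko).2

/-- **(INV) composes with a star gadget** (C-041.md §10 (b) + (f)): the glue of the star gadget with any
sub-problem satisfies (INV) at the star's centre. -/
theorem INV_glue_star_left (Q : Space X) :
    (glue (starSpace kt ko) RhoS (RhoS' kt ko) Q).I ≤
        (glue (starSpace kt ko) RhoS (RhoS' kt ko) Q).m₁ (fun s => RhoS s.1) ∧
      (glue (starSpace kt ko) RhoS (RhoS' kt ko) Q).I ≤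
        (glue (starSpace kt ko) RhoS (RhoS' kt ko) Q).m₂ (fun s => RhoS' kt ko s.1) :=
  INV_glue_left _ _ _ Q _ _ (starSpace_INV kt ko).1 (starSpace_INV kt ko).2

end InvStar

end PercRepro
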